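import Summits.KontsevichZagierPeriods.KontsevichZagierPeriods.Theses.WeightLine

/-!
# Line `constancy-exhaustion` for crux `WeightLine.BackwardVolterraRigidity` (stmt-KontsevichZagierPeriods-7177)

Crux-strategist r1 (RESTATED re-audit, BC2 REDIRECT), 2026-08-17. The crux (BVR): for classical total
representations `R_j : KZ.IntegralRep (d_j+1)` (level `s` = last coordinate), `k_j ∈ ℤ`, `c : KZ.FormalRep`:
if for every rational `t > 0` and all presentations `S_j` of the slices at `t`, `T_j` of the upper
truncations `R_j ∩ {s > t}` one has `Σ k_j([S_j] + [T_j]) − c ∈ KZ.relations` (hypothesis `H(c)`), then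
`c ∈ KZ.relations` and `Σ k_j [R_j ∩ {s > 0}] ∈ KZ.relations`. Write `D(t) = Σ k_j [R_j ∩ {s>t}]`,
`G(t) = Σ k_j [slice_t R_j]`, `B(a,b] = Σ k_j [R_j ∩ {a < s ≤ b}]` (any presentations).

TYPED DECOMPOSITION (two pieces = route items since rev 6: `WeightLine.UpperTruncationConstancy` stmt-KontsevichZagierPeriods-17729, `WeightLine.TruncationExhaustion` stmt-17730; glue item `WeightLine.BackwardVolterraRigidityOfPieces` stmt-17731, proved here BY NAME):
* `UpperTruncationConstancy` (RIGIDITY + TAMENESS, no limits): `H(c)` ⇒ there is a FINITE set `F ⊂ ℚ` of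
  exceptional levels with `D(t) − c ∈ relations` for every rational `t > 0`, `t ∉ F`.
* `TruncationExhaustion` (LIMITS only): for a level `t₀` and a finite exceptional set `F`: if every level
  band `B(a,b]` with rational ends `t₀ < a < b` outside `F` is a relation, then `D(t₀)` is a relation.
Assembly `backwardVolterraRigidity_of_pieces` (proved, ~45 lines, rule (1) only): constancy at two good
levels + domain additivity ⇒ good bands above `0` are relations; a good level `a₀ > 0` exists (F finite),
exhaustion at `a₀` gives `D(a₀) ∈ rel`, constancy gives `D(a₀) − c ∈ rel`, so `c ∈ rel`; exhaustion at
`t₀ = 0` gives `D(0) ∈ rel`.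

ONE LEVEL DOWN (the four registered stubs, two per piece):
* `stub_sliceVanishing` (S1, hardest, the NSE core "no semialgebraic Volterra eigenfamily"): `H(c)` ⇒
  `G(t) ∈ relations` at every rational level `t > 0` (all slice presentations; vacuous where the slices
  are not presentable). Values shadow: `v + V = C`, `V' = −v` a.e., `V → 0` ⇒ `V − C = Ae^t` ⇒ `A = C = 0`.
* `stub_levelTameness` (S2, unconditional tame analysis, Comte–Lion–Rolin / Cluckers–Miller + Fubini):
  all but finitely many rational slices of an integral representation are integral representations.
* `stub_topExhaustion` (S3, the `+∞` end): if the bands `B(a,b]` are relations for all large rational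
  `b`, then `D(a)` is a relation.
* `stub_levelExhaustion` (S4, the limit at a level from above): if `D(a)` is a relation for all
  rational `a ∈ (t₀, t₀ + ε)`, then `D(t₀)` is a relation.
Compositions (proved): `upperTruncationConstancy_of : S1 → S2 → UpperTruncationConstancy`,
`truncationExhaustion_of : S3 → S4 → TruncationExhaustion`,
`BackwardVolterraRigidity_of : S1 → S2 → S3 → S4 → BackwardVolterraRigidity` (concludes the crux BY NAME).
S3, S4 (and each piece) follow from the kernel form of Conjecture 1 by dominated convergence / the
values computation, so only unprovability inside the four-move calculus threatens them; S2 is a theorem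
of tame integration; S1 is the open heart. Disproof.lean: none exists for this crux (2026-08-17).

References: Kontsevich–Zagier 2001 §1.2 (rules); Comte–Lion–Rolin, *Nature log-analytique du volume des
sous-analytiques*, Illinois J. Math. 44 (2000); Cluckers–Miller, *Stability under integration of sums of
products of real globally subanalytic functions and their logarithms*, Duke Math. J. 156 (2011), Thm 1.3;
route file `Theses/WeightLine.lean` (card N2 'NSE', TWO-LAYER PLAN).
-/

noncomputable section

open MeasureTheory Set
open Literature.NumberTheory.Transcendental Literature.NumberTheory.Transcendental.KZ

namespace Summit.KontsevichZagierPeriods.KontsevichZagierPeriods.Cruxes.BackwardVolterraRigidity.ConstancyExhaustion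

/-! ## Registered stubs (two per piece) -/

/-- **S1 · slice vanishing (the rigidity core, hardest).** Under `H(c)`, the slice combination
`G(t) = Σ k_j [slice_t R_j]` is a relation at every rational level `t > 0` (for all slice
presentations; vacuous at the finitely many levels where a slice is not presentable). "No
semialgebraic Volterra eigenfamily": the values obey `v + ∫_(>t) v = C`, forcing `v = Ae^t`, and
decay forces `A = C = 0`; implied by the kernel form of Conjecture 1. Cheapest rung: `d_j = 0`. -/
theorem stub_sliceVanishing :
    ∀ (J : ℕ) (d : Fin J → ℕ) (k : Fin J → ℤ) (R : (j : Fin J) → Literature.NumberTheory.Transcendental.KZ.IntegralRep (d j + 1)) (c : Literature.NumberTheory.Transcendental.KZ.FormalRep), (∀ t : ℚ, 0 < (t : ℝ) → ∀ (S : (j : Fin J) → Literature.NumberTheory.Transcendental.KZ.IntegralRep (d j)) (T : (j : Fin J) → Literature.NumberTheory.Transcendental.KZ.IntegralRep (d j + 1)), (∀ j, (S j).domain = {x | Fin.snoc x (t : ℝ) ∈ (R j).domain} ∧ Set.EqOn (S j).integrand (fun x => (R j).integrand (Fin.snoc x (t : ℝ))) (S j).domain ∧ (T j).domain = (R j).domain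 ∩ {z | (t : ℝ) < z (Fin.last (d j))} ∧ Set.EqOn (T j).integrand (R j).integrand (T j).domain) → ∑ j, k j • (Literature.NumberTheory.Transcendental.KZ.of (S j) + Literature.NumberTheory.Transcendental.KZ.of (T j)) - c ∈ Literature.NumberTheory.Transcendental.KZ.relations) → ∀ t : ℚ, 0 < (t : ℝ) → ∀ (S : (j : Fin J) → Literature.NumberTheory.Transcendental.KZ.IntegralRep (d j)), (∀ j, (S j).domain = {x | Fin.snoc x (t : ℝ) ∈ (R j).domain} ∧ Set.EqOn (S j).integrand (fun x => (R j).integrand (Fin.snoc x (t : ℝ))) (S j).domain) → ∑ j, k j • Literature.NumberTheory.Transcendental.KZ.of (S j) ∈ Literature.NumberTheory.Transcendental.KZ.relations := by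
  sorry

/-- **S2 · level tameness (unconditional).** All but finitely many rational slices of an integral
representation are integral representations (slice domain and integrand are `ℚ`-semialgebraic at a
rational level; integrability off a finite set of levels: Fubini gives a.e., tameness of parametric
integrals of semialgebraic families — Comte–Lion–Rolin 2000, Cluckers–Miller 2011 Thm 1.3 — makes the
bad set finite). Trivial for `d = 0`. -/
theorem stub_levelTameness :
    ∀ (d : ℕ) (R : Literature.NumberTheory.Transcendental.KZ.IntegralRep (d + 1)), ∃ F : Finset ℚ, ∀ t : ℚ, t ∉ F → ∃ S : Literature.NumberTheory.Transcendental.KZ.IntegralRep d, S.domain = {x | Fin.snoc x (t : ℝ) ∈ R.domain} ∧ Set.EqOn S.integrand (fun x => R.integrand (Fin.snoc x (t : ℝ))) S.domain := by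
  sorry

/-- **S3 · top exhaustion (the `+∞` end).** If the level bands `(a, b]` of the combination are
relations for all sufficiently large rational `b`, then the upper truncation at `a` is a relation.
Values: `V(a) − V(b) = 0` for large `b` and `V(b) → 0`; implied by the kernel form of Conjecture 1;
no move of the calculus passes to this limit. -/
theorem stub_topExhaustion :
    ∀ (J : ℕ) (d : Fin J → ℕ) (k : Fin J → ℤ) (R : (j : Fin J) → Literature.NumberTheory.Transcendental.KZ.IntegralRep (d j + 1)) (a b₀ : ℚ), (∀ b : ℚ, a < b → b₀ < b → ∀ (B : (j : Fin J) → Literature.NumberTheory.Transcendental.KZ.IntegralRep (d j + 1)), (∀ j, (B j).domain = (R j).domain ∩ {z | (a : ℝ) < z (Fin.last (d j)) ∧ z (Fin.last (d j)) ≤ (b : ℝ)} ∧ Set.EqOn (B j).integrand (R j).integrand (B j).domain) → ∑ j, k j • Literature.NumberTheory.Transcendental.KZ.of (B j) ∈ Literature.NumberTheory.Transcendental.KZ.relations) → ∀ (T : (j : Fin J) → Literature.NumberTheory.Transcendental.KZ.IntegralRep (d j + 1)), (∀ j, (T j).domain = (R j).domain ∩ {z | (a : ℝ) < z (Fin.last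 (d j))} ∧ Set.EqOn (T j).integrand (R j).integrand (T j).domain) → ∑ j, k j • Literature.NumberTheory.Transcendental.KZ.of (T j) ∈ Literature.NumberTheory.Transcendental.KZ.relations := by
  sorry

/-- **S4 · level exhaustion (the limit at a level, from above).** If the upper truncations `D(a)` are
relations for all rational `a` in some interval `(t₀, t₀ + ε)`, then `D(t₀)` is a relation.
Values: `V` is continuous (level sets are null); implied by the kernel form of Conjecture 1. -/
theorem stub_levelExhaustion :
    ∀ (J : ℕ) (d : Fin J → ℕ) (k : Fin J → ℤ) (R : (j : Fin J) → Literature.NumberTheory.Transcendental.KZ.IntegralRep (d j + 1)) (t₀ ε : ℚ), 0 < ε → (∀ a : ℚ, t₀ < a → a < t₀ + ε → ∀ (T : (j : Fin J) → Literature.NumberTheory.Transcendental.KZ.IntegralRep (d j + 1)), (∀ j, (T j).domain = (R j).domain ∩ {z | (a : ℝ) < z (Fin.last (d j))} ∧ Set.EqOn (T j).integrand (R j).integrand (T j).domain) → ∑ j, k j • Literature.NumberTheory.Transcendental.KZ.of (T j) ∈ Literature.NumberTheory.Transcendental.KZ.relations) → ∀ (T : (j : Fin J) → Literature.NumberTheory.Transcendental.KZ.IntegralRep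 (d j + 1)), (∀ j, (T j).domain = (R j).domain ∩ {z | (t₀ : ℝ) < z (Fin.last (d j))} ∧ Set.EqOn (T j).integrand (R j).integrand (T j).domain) → ∑ j, k j • Literature.NumberTheory.Transcendental.KZ.of (T j) ∈ Literature.NumberTheory.Transcendental.KZ.relations := by
  sorry

/-! ## Helper lemmas (rule (1) bookkeeping, finite sets of levels) -/

/-- The open upper half-space `{z | t < z_last}` of `ℝ^{d+1}` at a rational level `t` is
`ℚ`-semialgebraic (`{C t < X_last}`). [cite: BochnakCosteRoy1998, Def. 2.1.4] -/
theorem isSemialgebraic_setOf_lt_last (d : ℕ) (t : ℚ) :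
    Literature.ModelTheory.ExponentialFields.IsSemialgebraic ℚ
      {z : Fin (d + 1) → ℝ | (t : ℝ) < z (Fin.last d)} := by
  simpa [MvPolynomial.aeval_C, MvPolynomial.aeval_X] using
    Literature.ModelTheory.ExponentialFields.isSemialgebraic_setOf_eval_lt (k := ℚ) (R := ℝ)
      (MvPolynomial.C t : MvPolynomial (Fin (d + 1)) ℚ) (MvPolynomial.X (Fin.last d))

/-- **Upper truncations are presentable**: `R ∩ {s > t}` is an integral representation with the
same integrand (`KZ.IntegralRep.restrict`). [cite: KontsevichZagier2001, §1.2] -/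
theorem exists_upper_presentation {d : ℕ} (R : IntegralRep (d + 1)) (t : ℚ) :
    ∃ U : IntegralRep (d + 1),
      U.domain = R.domain ∩ {z | (t : ℝ) < z (Fin.last d)} ∧ U.integrand = R.integrand :=
  ⟨R.restrict _ (R.isSemialgebraic_domain.inter (isSemialgebraic_setOf_lt_last d t))
      inter_subset_left, rfl, rfl⟩

/-- **Splitting an upper truncation at a higher level** (rule (1a)): for rational `a < b` and
presentations `U` of `R ∩ {s > a}`, `B` of `R ∩ {a < s ≤ b}`, `U'` of `R ∩ {s > b}`,
`[U] − [B] − [U']` is a relation. [cite: KontsevichZagier2001, §1.2 rule (1)] -/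
theorem of_upper_sub_of_band_sub_of_upper_mem_relations {d : ℕ} (R U B U' : IntegralRep (d + 1))
    {a b : ℚ} (hab : a < b)
    (hU : U.domain = R.domain ∩ {z | (a : ℝ) < z (Fin.last d)} ∧ EqOn U.integrand R.integrand U.domain)
    (hB : B.domain = R.domain ∩ {z | (a : ℝ) < z (Fin.last d) ∧ z (Fin.last d) ≤ (b : ℝ)} ∧
      EqOn B.integrand R.integrand B.domain)
    (hU' : U'.domain = R.domain ∩ {z | (b : ℝ) < z (Fin.last d)} ∧
      EqOn U'.integrand R.integrand U'.domain) :
    of U - of B - of U' ∈ relations := by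
  have hab' : (a : ℝ) < b := by exact_mod_cast hab
  refine domainAddRel_subset_relations ⟨d + 1, U, B, U', ?_, ?_, ?_, ?_, rfl⟩
  · rw [hU.1, hB.1, hU'.1]
    ext z
    simp only [mem_inter_iff, mem_setOf_eq, mem_union]
    constructor
    · rintro ⟨hz, hza⟩
      rcases le_or_gt (z (Fin.last d)) b with hzb | hzb
      · exact Or.inl ⟨hz, hza, hzb⟩
      · exact Or.inr ⟨hz, hzb⟩
    · rintro (⟨hz, hza, -⟩ | ⟨hz, hzb⟩)
      · exact ⟨hz, hza⟩
      · exact ⟨hz, hab'.trans hzb⟩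
  · have : B.domain ∩ U'.domain = ∅ := by
      rw [hB.1, hU'.1]
      ext z
      simp only [mem_inter_iff, mem_setOf_eq, mem_empty_iff_false, iff_false]
      exact fun h => (not_lt.mpr h.1.2.2) h.2.2
    rw [this, measure_empty]
  · intro z hz
    have hzU : z ∈ U.domain := by
      rw [hU.1]; rw [hB.1] at hz
      exact ⟨hz.1, hz.2.1⟩
    rw [hU.2 hzU, hB.2 hz]
  · intro z hz
    have hzU : z ∈ U.domain := by
      rw [hU.1]; rw [hU'.1] at hz
      exact ⟨hz.1, hab'.trans hz.2⟩
    rw [hU.2 hzU, hU'.2 hz]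

/-- `ℤ`-combinations of relations are relations. [folklore] -/
theorem sum_zsmul_mem_relations {J : ℕ} (k : Fin J → ℤ) (x : Fin J → FormalRep)
    (hx : ∀ j, x j ∈ relations) : ∑ j, k j • x j ∈ relations :=
  relations.sum_mem fun j _ => relations.zsmul_mem (hx j) (k j)

/-- **A level band between two constancy levels is a relation**: if every presentation of the upper
truncation at `a` and at `b` (`a < b` rational) is congruent to `c`, then every presentation of the
band `(a, b]` of the combination is a relation (rule (1a) for arbitrary presentations).
[cite: KontsevichZagier2001, §1.2 rule (1)] -/
theorem band_mem_relations_of_constancy {J : ℕ} {d : Fin J → ℕ} (k : Fin J → ℤ)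
    (R : (j : Fin J) → IntegralRep (d j + 1)) (c : FormalRep) {a b : ℚ} (hab : a < b)
    (ha : ∀ (T : (j : Fin J) → IntegralRep (d j + 1)),
      (∀ j, (T j).domain = (R j).domain ∩ {z | (a : ℝ) < z (Fin.last (d j))} ∧
        EqOn (T j).integrand (R j).integrand (T j).domain) → ∑ j, k j • of (T j) - c ∈ relations)
    (hb : ∀ (T : (j : Fin J) → IntegralRep (d j + 1)),
      (∀ j, (T j).domain = (R j).domain ∩ {z | (b : ℝ) < z (Fin.last (d j))} ∧
        EqOn (T j).integrand (R j).integrand (T j).domain) → ∑ j, k j • of (T j) - c ∈ relations)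
    (B : (j : Fin J) → IntegralRep (d j + 1))
    (hB : ∀ j, (B j).domain = (R j).domain ∩ {z | (a : ℝ) < z (Fin.last (d j)) ∧ z (Fin.last (d j)) ≤ (b : ℝ)} ∧
      EqOn (B j).integrand (R j).integrand (B j).domain) :
    ∑ j, k j • of (B j) ∈ relations := by
  choose U hUd hUi using fun j => exists_upper_presentation (R j) a
  choose U' hU'd hU'i using fun j => exists_upper_presentation (R j) b
  have hUp : ∀ j, (U j).domain = (R j).domain ∩ {z | (a : ℝ) < z (Fin.last (d j))} ∧
      EqOn (U j).integrand (R j).integrand (U j).domain :=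
    fun j => ⟨hUd j, fun z _ => congrFun (hUi j) z⟩
  have hU'p : ∀ j, (U' j).domain = (R j).domain ∩ {z | (b : ℝ) < z (Fin.last (d j))} ∧
      EqOn (U' j).integrand (R j).integrand (U' j).domain :=
    fun j => ⟨hU'd j, fun z _ => congrFun (hU'i j) z⟩
  have hsplit : ∑ j, k j • (of (U j) - of (B j) - of (U' j)) ∈ relations :=
    sum_zsmul_mem_relations k _ fun j =>
      of_upper_sub_of_band_sub_of_upper_mem_relations (R j) (U j) (B j) (U' j) hab
        (hUp j) (hB j) (hU'p j)
  have key : ∑ j, k j • of (B j) =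
      (∑ j, k j • of (U j) - c) - (∑ j, k j • of (U' j) - c) -
        ∑ j, k j • (of (U j) - of (B j) - of (U' j)) := by
    simp only [smul_sub, Finset.sum_sub_distrib]
    abel
  rw [key]
  exact relations.sub_mem (relations.sub_mem (ha U hUp) (hb U' hU'p)) hsplit

/-- A positive rational level avoiding a finite set of levels. [folklore] -/
theorem exists_pos_not_mem (F : Finset ℚ) : ∃ a : ℚ, 0 < a ∧ a ∉ F := by
  obtain ⟨M, hM⟩ := F.bddAbove
  refine ⟨max M 0 + 1, lt_of_le_of_lt (le_max_right M 0) (lt_add_one _), fun h => ?_⟩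
  have h1 : max M 0 + 1 ≤ M := hM (Finset.mem_coe.mpr h)
  have h2 : M ≤ max M 0 := le_max_left M 0
  linarith


/-- Above every element of a finite set of levels. [folklore] -/
theorem exists_forall_mem_lt (F : Finset ℚ) : ∃ M : ℚ, ∀ f ∈ F, f ≤ M := by
  obtain ⟨M, hM⟩ := F.bddAbove
  exact ⟨M, fun f hf => hM (Finset.mem_coe.mpr hf)⟩

/-- A gap above a level free of a finite set of levels. [folklore] -/
theorem exists_gap_above (F : Finset ℚ) (t₀ : ℚ) :
    ∃ ε : ℚ, 0 < ε ∧ ∀ f ∈ F, t₀ < f → t₀ + ε ≤ f := by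
  classical
  by_cases hG : (F.filter fun f => t₀ < f).Nonempty
  · refine ⟨(F.filter fun f => t₀ < f).min' hG - t₀, ?_, ?_⟩
    · have hmem := Finset.min'_mem _ hG
      have hlt : t₀ < (F.filter fun f => t₀ < f).min' hG := (Finset.mem_filter.mp hmem).2
      linarith
    · intro f hf hlt
      have hle : (F.filter fun f => t₀ < f).min' hG ≤ f :=
        Finset.min'_le _ _ (Finset.mem_filter.mpr ⟨hf, hlt⟩)
      linarith
  · exact ⟨1, one_pos, fun f hf hlt => absurd ⟨f, Finset.mem_filter.mpr ⟨hf, hlt⟩⟩ hG⟩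

/-! ## The pieces (route items) from the stubs -/

/-- **Piece 1 from its two stubs.** `UpperTruncationConstancy` from `stub_sliceVanishing` (S1) and
`stub_levelTameness` (S2): the exceptional set is the union over `j` of the finitely many
non-presentable rational levels of `R_j`; at any other level `t > 0` choose slice presentations `S_j`
(S2), apply `H(c)` to `(S, T)` and subtract `G(t) ∈ relations` (S1). [cite: KontsevichZagier2001, §1.2] -/
theorem upperTruncationConstancy_of
    (h₁ : ∀ (J : ℕ) (d : Fin J → ℕ) (k : Fin J → ℤ) (R : (j : Fin J) → Literature.NumberTheory.Transcendental.KZ.IntegralRep (d j + 1)) (c : Literature.NumberTheory.Transcendental.KZ.FormalRep), (∀ t : ℚ, 0 < (t : ℝ) → ∀ (S : (j : Fin J) → Literature.NumberTheory.Transcendental.KZ.IntegralRep (d j)) (T : (j : Fin J) → Literature.NumberTheory.Transcendental.KZ.IntegralRep (d j + 1)), (∀ j, (S j).domain = {x | Fin.snoc x (t : ℝ) ∈ (R j).domain} ∧ Set.EqOn (S j).integrand (fun x => (R j).integrand (Fin.snoc x (t : ℝ))) (S j).domain ∧ (T j).domain = (R j).domain ∩ {z | (t : ℝ) < z (Fin.last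 (d j))} ∧ Set.EqOn (T j).integrand (R j).integrand (T j).domain) → ∑ j, k j • (Literature.NumberTheory.Transcendental.KZ.of (S j) + Literature.NumberTheory.Transcendental.KZ.of (T j)) - c ∈ Literature.NumberTheory.Transcendental.KZ.relations) → ∀ t : ℚ, 0 < (t : ℝ) → ∀ (S : (j : Fin J) → Literature.NumberTheory.Transcendental.KZ.IntegralRep (d j)), (∀ j, (S j).domain = {x | Fin.snoc x (t : ℝ) ∈ (R j).domain} ∧ Set.EqOn (S j).integrand (fun x => (R j).integrand (Fin.snoc x (t : ℝ))) (S j).domain) → ∑ j, k j • Literature.NumberTheory.Transcendental.KZ.of (S j) ∈ Literature.NumberTheory.Transcendental.KZ.relations)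
    (h₂ : ∀ (d : ℕ) (R : Literature.NumberTheory.Transcendental.KZ.IntegralRep (d + 1)), ∃ F : Finset ℚ, ∀ t : ℚ, t ∉ F → ∃ S : Literature.NumberTheory.Transcendental.KZ.IntegralRep d, S.domain = {x | Fin.snoc x (t : ℝ) ∈ R.domain} ∧ Set.EqOn S.integrand (fun x => R.integrand (Fin.snoc x (t : ℝ))) S.domain) :
    Summit.KontsevichZagierPeriods.KontsevichZagierPeriods.Theses.WeightLine.UpperTruncationConstancy := by
  intro J d k R c hH
  classical
  choose F hF using fun j => h₂ (d j) (R j)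
  refine ⟨Finset.univ.biUnion F, ?_⟩
  intro t ht htF T hT
  have htj : ∀ j, t ∉ F j := fun j hj =>
    htF (Finset.mem_biUnion.mpr ⟨j, Finset.mem_univ j, hj⟩)
  choose S hSd hSi using fun j => hF j t (htj j)
  have hG : ∑ j, k j • of (S j) ∈ relations :=
    h₁ J d k R c hH t ht S fun j => ⟨hSd j, hSi j⟩
  have hGT : ∑ j, k j • (of (S j) + of (T j)) - c ∈ relations :=
    hH t ht S T fun j => ⟨hSd j, hSi j, (hT j).1, (hT j).2⟩
  have key : ∑ j, k j • of (T j) - c =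
      (∑ j, k j • (of (S j) + of (T j)) - c) - ∑ j, k j • of (S j) := by
    simp only [smul_add, Finset.sum_add_distrib]
    abel
  rw [key]
  exact relations.sub_mem hGT hG


/-- **Piece 2 from its two stubs.** `TruncationExhaustion` from `stub_topExhaustion` (S3) and
`stub_levelExhaustion` (S4): choose a gap `(t₀, t₀ + ε)` free of exceptional levels and a bound `M`
above them; for `a` in the gap every band `(a, b]` with `b > max M a` has both ends good, so S3 gives
`D(a) ∈ relations`; then S4 gives `D(t₀) ∈ relations`. [cite: KontsevichZagier2001, §1.2] -/
theorem truncationExhaustion_of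
    (h₃ : ∀ (J : ℕ) (d : Fin J → ℕ) (k : Fin J → ℤ) (R : (j : Fin J) → Literature.NumberTheory.Transcendental.KZ.IntegralRep (d j + 1)) (a b₀ : ℚ), (∀ b : ℚ, a < b → b₀ < b → ∀ (B : (j : Fin J) → Literature.NumberTheory.Transcendental.KZ.IntegralRep (d j + 1)), (∀ j, (B j).domain = (R j).domain ∩ {z | (a : ℝ) < z (Fin.last (d j)) ∧ z (Fin.last (d j)) ≤ (b : ℝ)} ∧ Set.EqOn (B j).integrand (R j).integrand (B j).domain) → ∑ j, k j • Literature.NumberTheory.Transcendental.KZ.of (B j) ∈ Literature.NumberTheory.Transcendental.KZ.relations) → ∀ (T : (j : Fin J) → Literature.NumberTheory.Transcendental.KZ.IntegralRep (d j + 1)), (∀ j, (T j).domain = (R j).domain ∩ {z | (a : ℝ) < z (Fin.last (d j))} ∧ Set.EqOn (T j).integrand (R j).integrand (T j).domain) → ∑ j, k j • Literature.NumberTheory.Transcendental.KZ.of (T j) ∈ Literature.NumberTheory.Transcendental.KZ.relations)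
    (h₄ : ∀ (J : ℕ) (d : Fin J → ℕ) (k : Fin J → ℤ) (R : (j : Fin J) → Literature.NumberTheory.Transcendental.KZ.IntegralRep (d j + 1)) (t₀ ε : ℚ), 0 < ε → (∀ a : ℚ, t₀ < a → a < t₀ + ε → ∀ (T : (j : Fin J) → Literature.NumberTheory.Transcendental.KZ.IntegralRep (d j + 1)), (∀ j, (T j).domain = (R j).domain ∩ {z | (a : ℝ) < z (Fin.last (d j))} ∧ Set.EqOn (T j).integrand (R j).integrand (T j).domain) → ∑ j, k j • Literature.NumberTheory.Transcendental.KZ.of (T j) ∈ Literature.NumberTheory.Transcendental.KZ.relations) → ∀ (T : (j : Fin J) → Literature.NumberTheory.Transcendental.KZ.IntegralRep (d j + 1)), (∀ j, (T j).domain = (R j).domain ∩ {z | (t₀ : ℝ) < z (Fin.last (d j))} ∧ Set.EqOn (T j).integrand (R j).integrand (T j).domain) → ∑ j, k j • Literature.NumberTheory.Transcendental.KZ.of (T j) ∈ Literature.NumberTheory.Transcendental.KZ.relations) :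
    Summit.KontsevichZagierPeriods.KontsevichZagierPeriods.Theses.WeightLine.TruncationExhaustion := by
  intro J d k R t₀ F hBand T hT
  obtain ⟨M, hM⟩ := exists_forall_mem_lt F
  obtain ⟨ε, hε, hgap⟩ := exists_gap_above F t₀
  refine h₄ J d k R t₀ ε hε (fun a hta haε Ta hTa => ?_) T hT
  have haF : a ∉ F := fun haF => by
    have := hgap a haF hta
    linarith
  refine h₃ J d k R a (max M a) (fun b hab hMb B hB => hBand a b hta hab haF ?_ B hB) Ta hTa
  intro hbF
  have h1 : b ≤ M := hM b hbF
  have h2 : M ≤ max M a := le_max_left M a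
  linarith

/-! ## The crux from the pieces (the split's glue item, by name) -/

/-- **`BackwardVolterraRigidity` from its two pieces** (the split's glue, `UpperTruncationConstancy →
TruncationExhaustion → BackwardVolterraRigidity`). (i) Constancy at two good levels `a < b` plus domain
additivity (`band_mem_relations_of_constancy`, arbitrary presentations) make every level band with good
positive rational ends a relation; (ii) a good level `a₀ > 0` exists because the exceptional set is
finite; exhaustion at `a₀` makes `D(a₀)` a relation and constancy makes `D(a₀) − c` one, so `c ≡ 0`;
(iii) exhaustion at `t₀ = 0` makes `D(0)` a relation. Uses rule (1) of the calculus only.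
[cite: KontsevichZagier2001, §1.2 rule (1)] -/
theorem backwardVolterraRigidity_of_pieces
    (h₁ : Summit.KontsevichZagierPeriods.KontsevichZagierPeriods.Theses.WeightLine.UpperTruncationConstancy)
    (h₂ : Summit.KontsevichZagierPeriods.KontsevichZagierPeriods.Theses.WeightLine.TruncationExhaustion) :
    Summit.KontsevichZagierPeriods.KontsevichZagierPeriods.Theses.WeightLine.BackwardVolterraRigidity := by
  intro J d k R c hH
  obtain ⟨F, hF⟩ := h₁ J d k R c hH
  -- (i) every level band between two good positive rational levels is a relation
  have hBand : ∀ a b : ℚ, 0 < (a : ℝ) → a < b → a ∉ F → b ∉ F →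
      ∀ (B : (j : Fin J) → IntegralRep (d j + 1)),
      (∀ j, (B j).domain = (R j).domain ∩ {z | (a : ℝ) < z (Fin.last (d j)) ∧ z (Fin.last (d j)) ≤ (b : ℝ)} ∧
        EqOn (B j).integrand (R j).integrand (B j).domain) →
      ∑ j, k j • of (B j) ∈ relations := by
    intro a b ha hab haF hbF B hB
    have hb : 0 < (b : ℝ) := ha.trans (by exact_mod_cast hab)
    exact band_mem_relations_of_constancy k R c hab (hF a ha haF) (hF b hb hbF) B hB
  -- (ii) the jump: at a good positive level `a₀`, exhaustion gives `D(a₀) ∈ rel` and constancy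
  --      gives `D(a₀) − c ∈ rel`, hence `c ∈ rel`
  have hc : c ∈ relations := by
    obtain ⟨a₀, ha₀, ha₀F⟩ := exists_pos_not_mem F
    have ha₀' : 0 < ((a₀ : ℚ) : ℝ) := by exact_mod_cast ha₀
    choose U hUd hUi using fun j => exists_upper_presentation (R j) a₀
    have hUp : ∀ j, (U j).domain = (R j).domain ∩ {z | ((a₀ : ℚ) : ℝ) < z (Fin.last (d j))} ∧
        EqOn (U j).integrand (R j).integrand (U j).domain :=
      fun j => ⟨hUd j, fun z _ => congrFun (hUi j) z⟩
    have hU0 : ∑ j, k j • of (U j) ∈ relations :=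
      h₂ J d k R a₀ F (fun a b h0a hab haF hbF B hB =>
        hBand a b (by exact_mod_cast ha₀.trans h0a) hab haF hbF B hB) U hUp
    have hU1 : ∑ j, k j • of (U j) - c ∈ relations := hF a₀ ha₀' ha₀F U hUp
    have key : c = ∑ j, k j • of (U j) - (∑ j, k j • of (U j) - c) := by abel
    rw [key]
    exact relations.sub_mem hU0 hU1
  refine ⟨hc, fun T₀ hT₀ => ?_⟩
  -- (iii) the truncation at level 0: exhaustion at `t₀ = 0` with the same exceptional set
  refine h₂ J d k R 0 F (fun a b h0a hab haF hbF B hB =>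
    hBand a b (by exact_mod_cast h0a) hab haF hbF B hB) T₀ ?_
  intro j
  obtain ⟨h1, h2⟩ := hT₀ j
  exact ⟨by simpa using h1, h2⟩

/-- The glue item `WeightLine.BackwardVolterraRigidityOfPieces` (stmt-KontsevichZagierPeriods-17731), by name.
[cite: KontsevichZagier2001, §1.2 rule (1)] -/
theorem backwardVolterraRigidityOfPieces_proof : Summit.KontsevichZagierPeriods.KontsevichZagierPeriods.Theses.WeightLine.BackwardVolterraRigidityOfPieces := by
  intro h₁ h₂
  exact backwardVolterraRigidity_of_pieces h₁ h₂

/-! ## Composition: the crux from the four stubs, by name -/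

/-- **The line.** `BackwardVolterraRigidity` from S1–S4. [cite: KontsevichZagier2001, §1.2] -/
theorem BackwardVolterraRigidity_of :
    (∀ (J : ℕ) (d : Fin J → ℕ) (k : Fin J → ℤ) (R : (j : Fin J) → Literature.NumberTheory.Transcendental.KZ.IntegralRep (d j + 1)) (c : Literature.NumberTheory.Transcendental.KZ.FormalRep), (∀ t : ℚ, 0 < (t : ℝ) → ∀ (S : (j : Fin J) → Literature.NumberTheory.Transcendental.KZ.IntegralRep (d j)) (T : (j : Fin J) → Literature.NumberTheory.Transcendental.KZ.IntegralRep (d j + 1)), (∀ j, (S j).domain = {x | Fin.snoc x (t : ℝ) ∈ (R j).domain} ∧ Set.EqOn (S j).integrand (fun x => (R j).integrand (Fin.snoc x (t : ℝ))) (S j).domain ∧ (T j).domain = (R j).domain ∩ {z | (t : ℝ) < z (Fin.last (d j))} ∧ Set.EqOn (T j).integrand (R j).integrand (T j).domain) → ∑ j, k j • (Literature.NumberTheory.Transcendental.KZ.of (S j) + Literature.NumberTheory.Transcendental.KZ.of (T j)) - c ∈ Literature.NumberTheory.Transcendental.KZ.relations) → ∀ t : ℚ, 0 < (t : ℝ)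 → ∀ (S : (j : Fin J) → Literature.NumberTheory.Transcendental.KZ.IntegralRep (d j)), (∀ j, (S j).domain = {x | Fin.snoc x (t : ℝ) ∈ (R j).domain} ∧ Set.EqOn (S j).integrand (fun x => (R j).integrand (Fin.snoc x (t : ℝ))) (S j).domain) → ∑ j, k j • Literature.NumberTheory.Transcendental.KZ.of (S j) ∈ Literature.NumberTheory.Transcendental.KZ.relations) →
    (∀ (d : ℕ) (R : Literature.NumberTheory.Transcendental.KZ.IntegralRep (d + 1)), ∃ F : Finset ℚ, ∀ t : ℚ, t ∉ F → ∃ S : Literature.NumberTheory.Transcendental.KZ.IntegralRep d, S.domain = {x | Fin.snoc x (t : ℝ) ∈ R.domain} ∧ Set.EqOn S.integrand (fun x => R.integrand (Fin.snoc x (t : ℝ))) S.domain) →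
    (∀ (J : ℕ) (d : Fin J → ℕ) (k : Fin J → ℤ) (R : (j : Fin J) → Literature.NumberTheory.Transcendental.KZ.IntegralRep (d j + 1)) (a b₀ : ℚ), (∀ b : ℚ, a < b → b₀ < b → ∀ (B : (j : Fin J) → Literature.NumberTheory.Transcendental.KZ.IntegralRep (d j + 1)), (∀ j, (B j).domain = (R j).domain ∩ {z | (a : ℝ) < z (Fin.last (d j)) ∧ z (Fin.last (d j)) ≤ (b : ℝ)} ∧ Set.EqOn (B j).integrand (R j).integrand (B j).domain) → ∑ j, k j • Literature.NumberTheory.Transcendental.KZ.of (B j) ∈ Literature.NumberTheory.Transcendental.KZ.relations) → ∀ (T : (j : Fin J) → Literature.NumberTheory.Transcendental.KZ.IntegralRep (d j + 1)), (∀ j, (T j).domain = (R j).domain ∩ {z | (a : ℝ) < z (Fin.last (d j))} ∧ Set.EqOn (T j).integrand (R j).integrand (T j).domain) → ∑ j, k j • Literature.NumberTheory.Transcendental.KZ.of (T j) ∈ Literature.NumberTheory.Transcendental.KZ.relations) →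
    (∀ (J : ℕ) (d : Fin J → ℕ) (k : Fin J → ℤ) (R : (j : Fin J) → Literature.NumberTheory.Transcendental.KZ.IntegralRep (d j + 1)) (t₀ ε : ℚ), 0 < ε → (∀ a : ℚ, t₀ < a → a < t₀ + ε → ∀ (T : (j : Fin J) → Literature.NumberTheory.Transcendental.KZ.IntegralRep (d j + 1)), (∀ j, (T j).domain = (R j).domain ∩ {z | (a : ℝ) < z (Fin.last (d j))} ∧ Set.EqOn (T j).integrand (R j).integrand (T j).domain) → ∑ j, k j • Literature.NumberTheory.Transcendental.KZ.of (T j) ∈ Literature.NumberTheory.Transcendental.KZ.relations) → ∀ (T : (j : Fin J) → Literature.NumberTheory.Transcendental.KZ.IntegralRep (d j + 1)), (∀ j, (T j).domain = (R j).domain ∩ {z | (t₀ : ℝ) < z (Fin.last (d j))} ∧ Set.EqOn (T j).integrand (R j).integrand (T j).domain) → ∑ j, k j • Literature.NumberTheory.Transcendental.KZ.of (T j) ∈ Literature.NumberTheory.Transcendental.KZ.relations) →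
    Summit.KontsevichZagierPeriods.KontsevichZagierPeriods.Theses.WeightLine.BackwardVolterraRigidity :=
  fun h₁ h₂ h₃ h₄ =>
    backwardVolterraRigidity_of_pieces (upperTruncationConstancy_of h₁ h₂) (truncationExhaustion_of h₃ h₄)

/-- **Skeleton theorem** (closed form): the crux BY NAME from the four declared stubs BY NAME. -/
theorem BackwardVolterraRigidity_of_stubs : Summit.KontsevichZagierPeriods.KontsevichZagierPeriods.Theses.WeightLine.BackwardVolterraRigidity :=
  BackwardVolterraRigidity_of stub_sliceVanishing stub_levelTameness stub_topExhaustion stub_levelExhaustion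

end Summit.KontsevichZagierPeriods.KontsevichZagierPeriods.Cruxes.BackwardVolterraRigidity.ConstancyExhaustion

end
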